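import Mathlib.NumberTheory.NumberField.Basic
import Mathlib.RingTheory.Ideal.Norm.AbsNorm
import Mathlib.Analysis.SpecialFunctions.Pow.Real
import Literature.NumberTheory.LFunctions.LogIntegral
import HarnessLib

/-!
# The prime ideal theorem with de la Vallée-Poussin error term (Landau 1903)

Topic `Literature/NumberTheory/LFunctions` (next to `DedekindZeta.lean` and `LogIntegral.lean`).
One named fact filed by the librarian for work item `wi-05055` (routes
`Parity/PolynomialMobius`, `Parity/UnimodularColumns`: the log-weighted singular series and the
Gaussian prime count in smooth regions need the prime ideal theorem with an error term).

## Content (namespace `Literature.NumberField`)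

* `primeIdealCount K x = π_K(x)` — the number of nonzero prime ideals `𝔭` of the ring of
  integers `𝓞 K` with absolute norm `N𝔭 ≤ x` (a `Set.ncard`; the set is finite by Mathlib's
  `Ideal.finite_setOf_absNorm_le`, proved below as `finite_primeIdealsLE`).
* `primeIdealTheorem` — NAMED FACT (Landau 1903; Montgomery–Vaughan 2007, pp. 266–268): for
  every number field `K` there are `c_K > 0` and `C_K` with
  `|π_K(x) − Li(x)| ≤ C_K · x · exp(−c_K √(log x))` for all `x ≥ 2`, where
  `Li = Literature.offsetLogIntegral` is the offset logarithmic integral `∫₂ˣ dt / log t`.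

## Design choices

* `Li` rather than `li`: the two differ by the constant `li 2 ≈ 1.045`, absorbed in `C_K`.
* The constants depend on `K` only (as in the sources); no uniformity in the discriminant is
  claimed (that is Lagarias–Odlyzko 1977, not vendored here).
* The bound is stated for all `x ≥ 2` with an explicit constant `C_K` instead of an `O_K(·)`
  (equivalent, since both sides are locally bounded on `[2, ∞)`).
* `K : Type` (universe `0`) inside the `Prop`; every number field is isomorphic to one in
  `Type` (a subfield of `ℂ`, or `ℚ[X]/(f)`).

## References

* E. Landau, *Neuer Beweis des Primzahlsatzes und Beweis des Primidealsatzes*, Math. Ann. 56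
  (1903), 645–670 (`LandauMathAnn1903`; the interim stub key `Landau1903` is superseded).
* H. L. Montgomery, R. C. Vaughan, *Multiplicative Number Theory I. Classical Theory*,
  Cambridge Stud. Adv. Math. 97 (2007), pp. 266–268 (`MontgomeryVaughan2007`).
-/

noncomputable section

open scoped NumberField

namespace Literature.NumberTheory.LFunctions.NumberField

variable (K : Type*) [Field K] [NumberField K]

/-- The set of nonzero prime ideals `𝔭` of `𝓞 K` with absolute norm `N𝔭 ≤ x`.
Landau 1903; Montgomery–Vaughan 2007, p. 266. [cite: MontgomeryVaughan2007, pp. 266–268] -/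
def primeIdealsLE (x : ℝ) : Set (Ideal (𝓞 K)) :=
  {P | P.IsPrime ∧ P ≠ ⊥ ∧ (Ideal.absNorm P : ℝ) ≤ x}

/-- The prime-ideal counting function `π_K(x) = #{𝔭 ⊂ 𝓞 K prime, 𝔭 ≠ 0, N𝔭 ≤ x}`.
Landau 1903; Montgomery–Vaughan 2007, p. 266. [cite: MontgomeryVaughan2007, pp. 266–268] -/
def primeIdealCount (x : ℝ) : ℕ :=
  (primeIdealsLE K x).ncard

/-- The set of prime ideals of norm `≤ x` is finite (there are finitely many ideals of each
norm; Mathlib `Ideal.finite_setOf_absNorm_le`). [folklore] -/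
theorem finite_primeIdealsLE (x : ℝ) : (primeIdealsLE K x).Finite := by
  refine (Ideal.finite_setOf_absNorm_le (S := 𝓞 K) ⌊x⌋₊).subset ?_
  rintro P ⟨-, -, hP⟩
  exact Nat.le_floor hP

/-- `π_K` is monotone in `x`. [folklore] -/
theorem primeIdealCount_mono : Monotone (primeIdealCount K) := by
  intro x y hxy
  refine Set.ncard_le_ncard ?_ (finite_primeIdealsLE K y)
  rintro P ⟨h1, h2, h3⟩
  exact ⟨h1, h2, h3.trans hxy⟩

/-- Below norm `1` there are no nonzero prime ideals: `π_K(x) = 0` for `x < 1` (a nonzero ideal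
of `𝓞 K` has absolute norm `≥ 1`). [folklore] -/
theorem primeIdealCount_eq_zero_of_lt_one {x : ℝ} (hx : x < 1) : primeIdealCount K x = 0 := by
  rw [primeIdealCount, Set.ncard_eq_zero (finite_primeIdealsLE K x)]
  ext P
  simp only [primeIdealsLE, Set.mem_setOf_eq, Set.mem_empty_iff_false, iff_false, not_and,
    not_le]
  intro _ hP
  refine hx.trans_le ?_
  have h : Ideal.absNorm P ≠ 0 := fun h0 => hP (Ideal.absNorm_eq_zero_iff.mp h0)
  exact_mod_cast Nat.one_le_iff_ne_zero.mpr h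

/-- **The prime ideal theorem with de la Vallée-Poussin error term** (Landau 1903; in the form of
Montgomery–Vaughan 2007, pp. 266–268). For every number field `K` there exist constants
`c_K > 0` and `C_K` such that for all `x ≥ 2`,
`|π_K(x) − Li(x)| ≤ C_K · x · exp(−c_K · √(log x))`,
where `π_K(x)` counts the nonzero prime ideals of `𝓞 K` of absolute norm at most `x` and
`Li(x) = ∫₂ˣ dt / log t` (`Literature.NumberTheory.LFunctions.offsetLogIntegral`). In particular `π_K(x) ∼ x / log x`.
[cite: LandauMathAnn1903, Primidealsatz] [cite: MontgomeryVaughan2007, pp. 266–268] -/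
def primeIdealTheorem : Prop :=
  ∀ (K : Type) [Field K] [NumberField K],
    ∃ c : ℝ, 0 < c ∧ ∃ C : ℝ, ∀ x : ℝ, 2 ≤ x →
      |(primeIdealCount K x : ℝ) - offsetLogIntegral x| ≤
        C * x * Real.exp (-c * Real.sqrt (Real.log x))

end Literature.NumberTheory.LFunctions.NumberField

end
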